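import Mathlib

/-!
# Group-lemma core, case `p ∤ N`: unipotent generation of the image of `Γ₁(N)` in `SL(2, ℤ/Npℤ)`

Blind cell `pub-manin-gamma0`, seat p3; paper reference `proofs/GL_congruence_kernel_p3.md`, Theorem GL, Case B.
For a prime `p ∤ N`, every `g ∈ SL(2, ℤ/Npℤ)` congruent to `(1 *; 0 1)` modulo `N` lies in the subgroup generated by
`T = (1 1; 0 1)` and `V = (1 0; N 1)`.  The proof checks an explicit word `V^{k₁} T^{N k₂} V^{k₃} T^{N k₄ + b}` against `g`
modulo `N` and modulo `p` (Chinese remainder theorem), the exponents coming from the standard factorisation of an element of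
`SL(2, 𝔽_p)` into elementary matrices.  Only Mathlib is imported; no definitions are introduced.
-/

namespace ManinGamma
namespace GLCoreB

open Matrix
open scoped MatrixGroups

/-- Entrywise criterion for equality of explicit `2 × 2` matrices. -/
theorem fin_two_eq {S : Type*} {a b c d a' b' c' d' : S} (h₁ : a = a') (h₂ : b = b') (h₃ : c = c')
    (h₄ : d = d') : !![a, b; c, d] = !![a', b'; c', d'] := by
  subst h₁ h₂ h₃ h₄; rfl

/-- Powers of an element of `SL(2,R)` with matrix `(1 1; 0 1)`. -/
theorem coe_pow_of_eq_T {R : Type*} [CommRing R] (T : SL(2, R))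
    (hT : (T : Matrix (Fin 2) (Fin 2) R) = !![1, 1; 0, 1]) (n : ℕ) :
    ((T ^ n : SL(2, R)) : Matrix (Fin 2) (Fin 2) R) = !![1, (n : R); 0, 1] := by
  induction n with
  | zero => simp [Matrix.one_fin_two]
  | succ k ih =>
    rw [pow_succ, Matrix.SpecialLinearGroup.coe_mul, ih, hT, Matrix.mul_fin_two]
    push_cast
    exact fin_two_eq (by ring) (by ring) (by ring) (by ring)

/-- Powers of an element of `SL(2,R)` with matrix `(1 0; ν 1)`. -/
theorem coe_pow_of_eq_V {R : Type*} [CommRing R] (ν : R) (V : SL(2, R))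
    (hV : (V : Matrix (Fin 2) (Fin 2) R) = !![1, 0; ν, 1]) (n : ℕ) :
    ((V ^ n : SL(2, R)) : Matrix (Fin 2) (Fin 2) R) = !![1, 0; (n : R) * ν, 1] := by
  induction n with
  | zero => simp [Matrix.one_fin_two]
  | succ k ih =>
    rw [pow_succ, Matrix.SpecialLinearGroup.coe_mul, ih, hV, Matrix.mul_fin_two]
    push_cast
    exact fin_two_eq (by ring) (by ring) (by ring) (by ring)

/-- CRT injectivity: an element of `ℤ/(Np)ℤ` (`N, p` coprime) is determined by its images in `ℤ/Nℤ` and `ℤ/pℤ`. -/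
theorem zmod_eq_of_cast_eq {N p : ℕ} [NeZero (N * p)] (h : N.Coprime p) (x y : ZMod (N * p))
    (hN : (ZMod.cast x : ZMod N) = ZMod.cast y) (hp : (ZMod.cast x : ZMod p) = ZMod.cast y) :
    x = y := by
  apply (ZMod.chineseRemainder h).injective
  have hlcm : N.lcm p ∣ N * p := by simp [Nat.lcm_dvd_iff]
  show (ZMod.castHom hlcm (ZMod N × ZMod p)) x = (ZMod.castHom hlcm (ZMod N × ZMod p)) y
  rw [ZMod.castHom_apply, ZMod.castHom_apply]
  rw [ZMod.cast_eq_val, ZMod.cast_eq_val] at hN hp ⊢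
  ext
  · simpa using hN
  · simpa using hp

/-- Two elements of `SL(2, ℤ/Npℤ)` (`N, p` coprime) with equal images in `SL(2, ℤ/Nℤ)` and `SL(2, ℤ/pℤ)` are equal. -/
theorem sl_eq_of_map_eq {N p : ℕ} [NeZero (N * p)] (h : N.Coprime p) (g g' : SL(2, ZMod (N * p)))
    (hN : Matrix.SpecialLinearGroup.map (ZMod.castHom (dvd_mul_right N p) (ZMod N)) g =
      Matrix.SpecialLinearGroup.map (ZMod.castHom (dvd_mul_right N p) (ZMod N)) g')
    (hp : Matrix.SpecialLinearGroup.map (ZMod.castHom (dvd_mul_left p N) (ZMod p)) g =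
      Matrix.SpecialLinearGroup.map (ZMod.castHom (dvd_mul_left p N) (ZMod p)) g') : g = g' := by
  apply Subtype.ext
  ext i j
  have h₁ := congrArg (fun M : SL(2, ZMod N) => (M : Matrix (Fin 2) (Fin 2) (ZMod N)) i j) hN
  have h₂ := congrArg (fun M : SL(2, ZMod p) => (M : Matrix (Fin 2) (Fin 2) (ZMod p)) i j) hp
  simp only [Matrix.SpecialLinearGroup.map_apply_coe, RingHom.mapMatrix_apply, Matrix.map_apply,
    ZMod.castHom_apply] at h₁ h₂
  exact zmod_eq_of_cast_eq h _ _ h₁ h₂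

/-- Image of a power of `T` under reduction. -/
theorem coe_map_pow_T {R S : Type*} [CommRing R] [CommRing S] (π : R →+* S) (T : SL(2, R))
    (hT : (T : Matrix (Fin 2) (Fin 2) R) = !![1, 1; 0, 1]) (n : ℕ) :
    ((Matrix.SpecialLinearGroup.map π (T ^ n) : SL(2, S)) : Matrix (Fin 2) (Fin 2) S) = !![1, (n : S); 0, 1] := by
  rw [map_pow]
  apply coe_pow_of_eq_T
  rw [Matrix.SpecialLinearGroup.map_apply_coe, hT]
  ext i j
  fin_cases i <;> fin_cases j <;> simp

/-- Image of a power of `V` under reduction. -/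
theorem coe_map_pow_V {R S : Type*} [CommRing R] [CommRing S] (π : R →+* S) (ν : R) (V : SL(2, R))
    (hV : (V : Matrix (Fin 2) (Fin 2) R) = !![1, 0; ν, 1]) (n : ℕ) :
    ((Matrix.SpecialLinearGroup.map π (V ^ n) : SL(2, S)) : Matrix (Fin 2) (Fin 2) S) =
      !![1, 0; (n : S) * π ν, 1] := by
  rw [map_pow]
  apply coe_pow_of_eq_V
  rw [Matrix.SpecialLinearGroup.map_apply_coe, hV]
  ext i j
  fin_cases i <;> fin_cases j <;> simp

/-- Elementary factorisation in `SL(2, F)`, `F` a field: if `αδ - βγ = 1` and `s₃ = γ - s₁ α ≠ 0`, `s₂ s₃ = α - 1`,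
`s₄ s₃ = δ - γ b - s₁(β - α b) - 1`, then `(α β; γ δ) = E₂₁(s₁) E₁₂(s₂) E₂₁(s₃) E₁₂(s₄ + b)`. -/
theorem elem_factor {F : Type*} [Field F] (α β γ δ b s₁ s₂ s₃ s₄ : F) (hdet : α * δ - β * γ = 1)
    (hs₃ : s₃ = γ - s₁ * α) (h0 : s₃ ≠ 0) (hs₂ : s₂ * s₃ = α - 1)
    (hs₄ : s₄ * s₃ = δ - γ * b - s₁ * (β - α * b) - 1) :
    !![α, β; γ, δ] = !![1, 0; s₁, 1] * !![1, s₂; 0, 1] * !![1, 0; s₃, 1] * !![1, s₄ + b; 0, 1] := by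
  simp only [Matrix.mul_fin_two]
  refine fin_two_eq ?_ ?_ ?_ ?_
  · linear_combination (-1 : F) * hs₂
  · rw [← sub_eq_zero]
    refine (mul_eq_zero.mp ?_).resolve_right h0
    linear_combination (-(s₄ * s₃) - b * s₃ - 1) * hs₂ + (-α) * hs₄ + (β - α * b) * hs₃ + (-1 : F) * hdet
  · linear_combination (-s₁) * hs₂ + (-1 : F) * hs₃
  · rw [← sub_eq_zero]
    refine (mul_eq_zero.mp ?_).resolve_right h0
    linear_combination (-s₁ * (s₄ * s₃ + b * s₃ + 1)) * hs₂ + (-s₁ * α - s₃) * hs₄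
      + (γ * b + s₁ * β - 2 * s₁ * α * b - b * s₃ - b * (γ - s₁ * α)) * hs₃ + (-s₁) * hdet

/-- **GL core, case `p ∤ N`.**  Let `p` be a prime not dividing `N ≥ 1`, and `T, V ∈ SL(2, ℤ/Npℤ)` with matrices `(1 1; 0 1)`,
`(1 0; N 1)`.  Every `g ∈ SL(2, ℤ/Npℤ)` of the form `(1 + N a, b; N c, 1 + N d)` lies in the subgroup generated by `T, V`. -/
theorem mem_closure_unipotent_coprime {N p : ℕ} [NeZero N] [Fact p.Prime] (hNp : ¬ p ∣ N)
    (T V g : SL(2, ZMod (N * p)))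
    (hT : (T : Matrix (Fin 2) (Fin 2) (ZMod (N * p))) = !![1, 1; 0, 1])
    (hV : (V : Matrix (Fin 2) (Fin 2) (ZMod (N * p))) = !![1, 0; (N : ZMod (N * p)), 1])
    (a b c d : ZMod (N * p)) (h₀₀ : (g : Matrix (Fin 2) (Fin 2) (ZMod (N * p))) 0 0 = 1 + N * a)
    (h₀₁ : (g : Matrix (Fin 2) (Fin 2) (ZMod (N * p))) 0 1 = b)
    (h₁₀ : (g : Matrix (Fin 2) (Fin 2) (ZMod (N * p))) 1 0 = N * c)
    (h₁₁ : (g : Matrix (Fin 2) (Fin 2) (ZMod (N * p))) 1 1 = 1 + N * d) :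
    g ∈ Subgroup.closure ({T, V} : Set SL(2, ZMod (N * p))) := by
  have hp : p.Prime := Fact.out
  haveI : NeZero (N * p) := ⟨Nat.mul_ne_zero (NeZero.ne N) hp.ne_zero⟩
  have hcop : N.Coprime p := (Nat.Coprime.symm ((Nat.Prime.coprime_iff_not_dvd hp).mpr hNp))
  set πN := ZMod.castHom (dvd_mul_right N p) (ZMod N) with hπN
  set πp := ZMod.castHom (dvd_mul_left p N) (ZMod p) with hπp
  -- the residue ν of N mod p is a unit
  set ν : ZMod p := (N : ZMod p) with hν
  have hν0 : ν ≠ 0 := by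
    rw [hν, Ne, ZMod.natCast_eq_zero_iff]; exact hNp
  have hπpN : πp (N : ZMod (N * p)) = ν := by simp [hπp, hν]
  have hπNN : πN (N : ZMod (N * p)) = 0 := by simp [hπN]
  -- p-images of the entries of g
  set α : ZMod p := πp ((g : Matrix (Fin 2) (Fin 2) (ZMod (N * p))) 0 0) with hα
  set β : ZMod p := πp ((g : Matrix (Fin 2) (Fin 2) (ZMod (N * p))) 0 1) with hβ
  set γ : ZMod p := πp ((g : Matrix (Fin 2) (Fin 2) (ZMod (N * p))) 1 0) with hγ
  set δ : ZMod p := πp ((g : Matrix (Fin 2) (Fin 2) (ZMod (N * p))) 1 1) with hδ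
  have hdet : α * δ - β * γ = 1 := by
    have h := congrArg πp (Matrix.SpecialLinearGroup.det_coe g)
    rw [Matrix.det_fin_two, map_one, map_sub, map_mul, map_mul] at h
    rw [hα, hβ, hγ, hδ]; exact h
  set bp : ZMod p := πp b with hbp
  have hbp' : bp = ((b.val : ℕ) : ZMod p) := by
    rw [hbp, hπp, ZMod.castHom_apply, ZMod.natCast_val]
  -- the elementary factorisation in SL(2, 𝔽_p): choose s₁ ∈ {0, -1} so that s₃ := γ - s₁ α ≠ 0
  obtain ⟨s₁, h0⟩ : ∃ s₁ : ZMod p, γ - s₁ * α ≠ 0 := by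
    by_cases hγ0 : γ = 0
    · refine ⟨-1, ?_⟩
      have hα0 : α ≠ 0 := by
        intro hα0; rw [hα0, hγ0] at hdet; simp at hdet
      simpa [hγ0] using hα0
    · exact ⟨0, by simpa using hγ0⟩
  obtain ⟨s₃, hs₃⟩ : ∃ s : ZMod p, s = γ - s₁ * α := ⟨_, rfl⟩
  rw [← hs₃] at h0
  obtain ⟨s₂, hs₂⟩ : ∃ s : ZMod p, s * s₃ = α - 1 := ⟨(α - 1) / s₃, div_mul_cancel₀ _ h0⟩
  obtain ⟨s₄, hs₄⟩ : ∃ s : ZMod p, s * s₃ = δ - γ * bp - s₁ * (β - α * bp) - 1 :=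
    ⟨(δ - γ * bp - s₁ * (β - α * bp) - 1) / s₃, div_mul_cancel₀ _ h0⟩
  -- natural-number exponents realising the sᵢ as multiples of ν
  obtain ⟨k₁, hk₁⟩ : ∃ k : ℕ, (k : ZMod p) * ν = s₁ := ⟨(s₁ * ν⁻¹).val, by rw [ZMod.natCast_zmod_val]; field_simp⟩
  obtain ⟨k₂, hk₂⟩ : ∃ k : ℕ, (k : ZMod p) * ν = s₂ := ⟨(s₂ * ν⁻¹).val, by rw [ZMod.natCast_zmod_val]; field_simp⟩
  obtain ⟨k₃, hk₃⟩ : ∃ k : ℕ, (k : ZMod p) * ν = s₃ := ⟨(s₃ * ν⁻¹).val, by rw [ZMod.natCast_zmod_val]; field_simp⟩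
  obtain ⟨k₄, hk₄⟩ : ∃ k : ℕ, (k : ZMod p) * ν = s₄ := ⟨(s₄ * ν⁻¹).val, by rw [ZMod.natCast_zmod_val]; field_simp⟩
  -- the word
  set w : SL(2, ZMod (N * p)) := V ^ k₁ * T ^ (N * k₂) * V ^ k₃ * T ^ (N * k₄ + b.val) with hw
  have key : g = w := by
    apply sl_eq_of_map_eq hcop
    · -- modulo N: both sides are (1, b; 0, 1)
      apply Subtype.ext
      rw [hw, map_mul, map_mul, map_mul, Matrix.SpecialLinearGroup.coe_mul, Matrix.SpecialLinearGroup.coe_mul,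
        Matrix.SpecialLinearGroup.coe_mul, coe_map_pow_V πN (N : ZMod (N * p)) V hV,
        coe_map_pow_T πN T hT, coe_map_pow_V πN (N : ZMod (N * p)) V hV, coe_map_pow_T πN T hT, hπNN,
        Matrix.SpecialLinearGroup.map_apply_coe, RingHom.mapMatrix_apply,
        Matrix.eta_fin_two ((g : Matrix (Fin 2) (Fin 2) (ZMod (N * p))).map πN)]
      simp only [Matrix.map_apply, h₀₀, h₀₁, h₁₀, h₁₁, map_add, map_one, map_mul, hπNN, Matrix.mul_fin_two]
      have hb : πN b = ((b.val : ℕ) : ZMod N) := by rw [hπN, ZMod.castHom_apply, ZMod.natCast_val]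
      rw [hb]
      push_cast
      rw [ZMod.natCast_self]
      exact fin_two_eq (by ring) (by ring) (by ring) (by ring)
    · -- modulo p: the elementary factorisation
      apply Subtype.ext
      rw [hw, map_mul, map_mul, map_mul, Matrix.SpecialLinearGroup.coe_mul, Matrix.SpecialLinearGroup.coe_mul,
        Matrix.SpecialLinearGroup.coe_mul, coe_map_pow_V πp (N : ZMod (N * p)) V hV,
        coe_map_pow_T πp T hT, coe_map_pow_V πp (N : ZMod (N * p)) V hV, coe_map_pow_T πp T hT, hπpN,
        Matrix.SpecialLinearGroup.map_apply_coe, RingHom.mapMatrix_apply,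
        Matrix.eta_fin_two ((g : Matrix (Fin 2) (Fin 2) (ZMod (N * p))).map πp)]
      simp only [Matrix.map_apply, ← hα, ← hβ, ← hγ, ← hδ]
      have e₂ : ((N * k₂ : ℕ) : ZMod p) = s₂ := by push_cast; rw [← hν, mul_comm, hk₂]
      have e₄ : ((N * k₄ + b.val : ℕ) : ZMod p) = s₄ + bp := by
        push_cast; rw [← hν, mul_comm, hk₄, hbp']
      rw [hk₁, hk₃, e₂, e₄]
      exact elem_factor α β γ δ bp s₁ s₂ s₃ s₄ hdet hs₃ h0 hs₂ hs₄
  rw [key, hw]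
  have hT' : T ∈ Subgroup.closure ({T, V} : Set SL(2, ZMod (N * p))) := Subgroup.subset_closure (by simp)
  have hV' : V ∈ Subgroup.closure ({T, V} : Set SL(2, ZMod (N * p))) := Subgroup.subset_closure (by simp)
  exact Subgroup.mul_mem _ (Subgroup.mul_mem _ (Subgroup.mul_mem _ (Subgroup.pow_mem _ hV' _)
    (Subgroup.pow_mem _ hT' _)) (Subgroup.pow_mem _ hV' _)) (Subgroup.pow_mem _ hT' _)

end GLCoreB
end ManinGamma
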